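import Summits.BirchSwinnertonDyer.BirchSwinnertonDyer.Theses.VerticalContact
import Literature.NumberTheory.EllipticCurves.KatoRankBound
import Literature.NumberTheory.EllipticCurves.KatoRankBoundSelmerProofs
import HarnessLib

/-!
# Route VerticalContact — crux `PGSelmerBSD` (stmt-BirchSwinnertonDyer-17810), line `Sketch`,
# stub `stub_katoBound`: conditional closures (Kato, Astérisque 295, Thm 18.4 / Thm 17.4)

Registered stub 3 of `Cruxes/PGSelmerBSD/Lines/Sketch.lean`: at an admissible prime `p` (`p ≥ 5`,
good ordinary, `ρ̄_{E,p}` surjective) of a curve `E/ℚ` (globally minimal `W`) with `r_an ≥ 2`, for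
every newform `f` of `E`, `corank_{ℤ_p} Sel_{p^∞}(E/ℚ) ≤ ord_{T=0} L_p(f, α_p, T)` in `ℕ∞`. KNOWN IN
PRINT (K. Kato, Astérisque 295 (2004), Thm 18.4, p. 281), not provable in the tree today: it is the
named fact `kato_selmerCorank_le_order_padicLFunction` (file `KatoRankBound`, undischarged)
specialised (`p ≥ 5 ⇒ p ≠ 2`; good + `p ∤ a_p` is `IsOrdinaryAt W p` by `Iff.rfl`; the binders
`ρ̄` surjective and `2 ≤ r_an` are unused). The finest undischarged leaf behind that fact is
`kato_divisibility` (file `PAdicBSD`; Kato Thm 17.4: `X(E/ℚ_∞)` is `Λ`-torsion and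
`char_Λ X ∣ p^n L_p(E,T)`), through the PROVED reduction
`kato_selmerCorank_le_order_padicLFunction_of_kato_divisibility` (file `KatoRankBoundSelmerProofs`).
This file records both closures, machine-checked; neither closes the stub.
-/

-- D-0017: single-problem summit, so `Summit.BirchSwinnertonDyer.BirchSwinnertonDyer.…` repeats a
-- namespace BY DESIGN (the `Summits` lib sets this option in `lakefile.toml`; repeated for standalone checks).
set_option linter.dupNamespace false

namespace Summit.BirchSwinnertonDyer.BirchSwinnertonDyer.Theorems

open scoped MatrixGroups ModularForm
open CongruenceSubgroup Literature.NumberTheory.EllipticCurves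
  Literature.NumberTheory.EllipticCurves.ModularForms

/-- **Stub `stub_katoBound` from Kato's Thm 18.4 (Selmer-corank form).** Antecedent: the
∀-closure over `(W, p, N, f)` of the named fact `kato_selmerCorank_le_order_padicLFunction`
(K. Kato, Astérisque 295 (2004), Thm 18.4, p. 281, non-exceptional clause, `k = 2`, `K = ℚ`, odd
good ordinary `p`). Consequent: the registered stub verbatim. Proof: `p ≥ 5` is odd and
`IsOrdinaryAt W p` is `⟨good, p ∤ a_p⟩`; surjectivity of `ρ̄_{E,p}` and `2 ≤ r_an` are not used.
CONDITIONAL on the named fact. [cite: Kato2004Asterisque, Thm. 18.4 (p. 281)] -/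
theorem stub_katoBound_of_facts :
    (∀ (W : WeierstrassCurve ℚ) [W.IsElliptic] [W.IsGloballyMinimal] (p : ℕ) [Fact p.Prime]
      {N : ℕ} [NeZero N] {f : CuspForm (Gamma0 N) 2},
      Literature.NumberTheory.EllipticCurves.kato_selmerCorank_le_order_padicLFunction W p (f := f)) →
    ∀ (W : WeierstrassCurve ℚ) [W.IsElliptic] [W.IsGloballyMinimal] (p : ℕ) [Fact p.Prime],
      5 ≤ p → W.HasGoodReductionAtPrime p → ¬ (p : ℤ) ∣ W.frobeniusTrace p →
        W.HasSurjectiveModNGaloisRep p → 2 ≤ W.analyticRank →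
        ∀ {N : ℕ} [NeZero N] (f : CuspForm (Gamma0 N) 2), IsNewformOf W f →
          (W.selmerCorank p : ℕ∞) ≤ (padicLFunction f (unitRoot W p : ℚ_[p])).order := by
  intro hKato W _ _ p _ h5 hgood hord _hsurj _h2 N _ f hf
  exact hKato W p (by omega) ⟨hgood, hord⟩ hf

/-- **Stub `stub_katoBound` from Kato's divisibility (Thm 17.4) alone.** Antecedent: the
∀-closure over `(W, p, κ, γ, N, f)` of the named fact `kato_divisibility` (K. Kato, Astérisque 295
(2004), Thm 17.4, p. 273: for odd good ordinary `p` and every cyclotomic datum, `X(E/ℚ_∞)` is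
`Λ`-torsion and `p^n L_p(E,T) = ι g` for some `g ∈ char_Λ X`; clause (3), the integral
refinement, is not used). Consequent: the registered stub verbatim, through the tree theorem
`kato_selmerCorank_le_order_padicLFunction_of_kato_divisibility` (cyclotomic datum, dual datum,
finite generation over `Λ`, `corank Sel ≤ rank_{ℤ_p} X/TX ≤ ord_T g ≤ ord_T L_p`: all proved) and
`stub_katoBound_of_facts`. CONDITIONAL on the named fact.
[cite: Kato2004Asterisque, Thm. 17.4 (p. 273) and Thm. 18.4 (p. 281)] -/
theorem stub_katoBound_of_kato_divisibility :
    (∀ (W : WeierstrassCurve ℚ) [W.IsElliptic] [W.IsGloballyMinimal] (p : ℕ) [Fact p.Prime]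
      (κ : ZpExtension ℚ p) (γ : Field.absoluteGaloisGroup ℚ) {N : ℕ} [NeZero N]
      {f : CuspForm (Gamma0 N) 2},
      Literature.NumberTheory.EllipticCurves.kato_divisibility W p (κ := κ) (γ := γ) (f := f)) →
    ∀ (W : WeierstrassCurve ℚ) [W.IsElliptic] [W.IsGloballyMinimal] (p : ℕ) [Fact p.Prime],
      5 ≤ p → W.HasGoodReductionAtPrime p → ¬ (p : ℤ) ∣ W.frobeniusTrace p →
        W.HasSurjectiveModNGaloisRep p → 2 ≤ W.analyticRank →
        ∀ {N : ℕ} [NeZero N] (f : CuspForm (Gamma0 N) 2), IsNewformOf W f →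
          (W.selmerCorank p : ℕ∞) ≤ (padicLFunction f (unitRoot W p : ℚ_[p])).order :=
  fun hdiv => stub_katoBound_of_facts fun W _ _ p _ _ _ _ =>
    kato_selmerCorank_le_order_padicLFunction_of_kato_divisibility W p fun κ γ => hdiv W p κ γ

end Summit.BirchSwinnertonDyer.BirchSwinnertonDyer.Theorems
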